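import Mathlib
import Summits.Ventures.HodgeRepro.Tier4.Line1.OrbitalTools
import Summits.Ventures.HodgeRepro.Tier4.Line1.OrbitalPhase

/-!
# Tier4/Line1/OrbitalPositive — LINE L1, J2.c′ rung (c′.2): a bump at `γ₀` has an orbital term of positive real part

Blind re-derivation cell `pub-hodge-repro`, Tier 4 «prove the step» (README §9–§10), seat t4-L1-p2 (prover, gen 0),
LINE L1 (t4-plan-1), assignment S12232 (J2.c′), rungs S12304.  THE LEMMA: for `[Countable Gk]`, `G` locally compact
Hausdorff, characters `χ`, `χ'` with `CentralMatch`, an adelically regular rational `γ₀` and an open `U ∋ γ₀`, there is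
a test function `f₁` with `tsupport f₁ ⊆ U` and `Re O_{[γ₀]}(f₁) > 0`.  THE PROOF: `V₀` a compact neighbourhood of
`γ₀`; `Γ₀` the finite set (c′.0) of rational points reaching `V₀` from the closures, `Γ₁` its fibre over the orbit of
`γ₀`, with rational pairs `γ = q₁ γ₀ q₂` (`DoubleCoset.eq`); `K = ⋃ q₁⁻¹ · closure DT`, `K' = ⋃ q₂ · closure DT'`
(finite unions, compact); `V` from (c′.1) on `U ∩ interior V₀`; `f₁ = b` a Urysohn bump in `[0, 1]`, `b(γ₀) = 1`,
supported in an open `V'` with `closure V' ⊆ V`.  On `closure DT × closure DT'` the partial kernel is the real finite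
sum `r(t, t') = ∑_{γ ∈ Γ₁} b(t⁻¹ γ t')`, and the phase `χ(t) conj χ'(t')` (independent of `γ`) has real part `> 1/2`
whenever some term is positive (`χ(q₁⁻¹ t) = χ(t)`, `χ'(q₂ t') = χ'(t')` by rationality, and `(q₁⁻¹ t, q₂ t') ∈ K × K'`
maps to `t⁻¹ γ t' ∈ V`), so `Re(integrand) ≥ r/2 ≥ 0`.  Positivity: the orbit map sends a product `N × N'` of open
neighbourhoods of `1` into `{b > 0}`; `ae_covers` + countability + `IsOpenPosMeasure` + left invariance give pieces
`N₁ ⊆ DT`, `N₁' ⊆ DT'` of positive measure with `g⁻¹ N₁ ⊆ N`, `g'⁻¹ N₁' ⊆ N'` for rational `g`, `g'`, and the rational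
`γ = g γ₀ g'⁻¹` makes `r > 0` on `N₁ × N₁'`; `Re ∘ ∫∫ = ∫∫ ∘ Re` (`ContinuousLinearMap.integral_comp_comm`, the
integrability of `OrbitalTools`) and `setIntegral_pos_iff_support_of_nonneg_ae` twice.
Imports Mathlib + `OrbitalTools` + `OrbitalPhase` only.

Nothing here says anything about the status of the Hodge conjecture for CM abelian varieties, which is NOT proved
(HC_CM is NOT proved by anyone in this repository).
-/

set_option autoImplicit false

noncomputable section

/-! ## OrbitalPositive — (c′.2): a non-negative bump at an adelically regular rational `γ₀` has an orbital term
with POSITIVE real part (t4-L1-p2, for J2.c′) -/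

namespace Summit.Ventures.HodgeRepro.Tier4.Line1.RTF

open MeasureTheory Topology Filter Set
open scoped Pointwise

variable {G : Type} [Group G] [TopologicalSpace G] [IsTopologicalGroup G] [MeasurableSpace G]
  [BorelSpace G]

namespace Setting

variable (S : Setting G)

open Classical in
/-- (c′.2, L) A NON-NEGATIVE BUMP at `γ₀` has an orbital term with POSITIVE real part: with `V` from (c′.1) for the
finitely many rational translates of `closure DT`, `closure DT'` that reach a compact neighbourhood of `γ₀`
((c′.0)), the orbital integrand of a bump `b ≥ 0` supported in `V` is `≥ b/2 ≥ 0` on `DT × DT'` in real part,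
and `> 0` on a product of sets of positive Haar measure (`ae_covers` + `[Countable Gk]` + `IsOpenPosMeasure`). -/
theorem exists_test_orbital_re_pos [Countable S.Gk] [LocallyCompactSpace G] [T2Space G] {χ : S.T → ℂ}
    {χ' : S.T' → ℂ} (hχ : S.IsCharacter χ) (hχ' : S.IsCharacter' χ') (hZ : S.CentralMatch χ χ') (γ₀ : S.Gk)
    (hreg : ∀ t ∈ S.T, ∀ t' ∈ S.T', t⁻¹ * γ₀ * t' = γ₀ → t ∈ S.Z ∧ t' = t) {U : Set G} (hU : IsOpen U)
    (hγ : (γ₀ : G) ∈ U) :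
    ∃ f₁ : G → ℂ, IsTest f₁ ∧ tsupport f₁ ⊆ U ∧ 0 < (S.orbital χ χ' (S.orbitOf γ₀) f₁).re := by
  haveI : IsFiniteMeasureOnCompacts S.μT := S.haarT.toIsFiniteMeasureOnCompacts
  haveI : IsFiniteMeasureOnCompacts S.μT' := S.haarT'.toIsFiniteMeasureOnCompacts
  haveI : S.μT.IsOpenPosMeasure := S.haarT.toIsOpenPosMeasure
  haveI : S.μT'.IsOpenPosMeasure := S.haarT'.toIsOpenPosMeasure
  haveI : S.μT.IsMulLeftInvariant := S.haarT.toIsMulLeftInvariant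
  haveI : S.μT'.IsMulLeftInvariant := S.haarT'.toIsMulLeftInvariant
  -- (1) a compact neighbourhood of `γ₀`
  obtain ⟨V₀, hV₀c, hV₀n⟩ := exists_compact_mem_nhds (γ₀ : G)
  -- (2) the rational points reaching `V₀` from the closures, and the fibre over the orbit of `γ₀`
  set Γ₀ : Finset S.Gk := (S.finite_hit_closure hV₀c).toFinset with hΓ₀
  set Γ₁ : Finset S.Gk := Γ₀.filter (fun γ => S.orbitOf γ = S.orbitOf γ₀) with hΓ₁
  -- (3) rational pairs `γ = p.1 γ₀ p.2` on the orbit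
  have hchoose : ∀ γ : S.Gk, ∃ q : S.Gk × S.Gk, S.orbitOf γ = S.orbitOf γ₀ →
      (q.1 : G) ∈ S.T ∧ (q.2 : G) ∈ S.T' ∧ γ = q.1 * γ₀ * q.2 := by
    intro γ
    by_cases h : S.orbitOf γ = S.orbitOf γ₀
    · obtain ⟨d, hd, d', hd', hγ⟩ := (DoubleCoset.eq _ _ _ _).1 h.symm
      exact ⟨(d, d'), fun _ => ⟨Subgroup.mem_subgroupOf.1 hd, Subgroup.mem_subgroupOf.1 hd', hγ⟩⟩
    · exact ⟨(1, 1), fun h' => absurd h' h⟩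
  choose q hq using hchoose
  -- the translations in `T` and `T'`
  set dT : S.Gk → S.T := fun γ =>
    if h : ((q γ).1 : G) ∈ S.T then ⟨((q γ).1 : G)⁻¹, S.T.inv_mem h⟩ else 1 with hdT
  set dT' : S.Gk → S.T' := fun γ =>
    if h : ((q γ).2 : G) ∈ S.T' then ⟨((q γ).2 : G), h⟩ else 1 with hdT'
  have hdT_val : ∀ γ, S.orbitOf γ = S.orbitOf γ₀ → (dT γ : G) = ((q γ).1 : G)⁻¹ := by
    intro γ hγ
    simp only [hdT, dif_pos (hq γ hγ).1]
  have hdT'_val : ∀ γ, S.orbitOf γ = S.orbitOf γ₀ → (dT' γ : G) = ((q γ).2 : G) := by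
    intro γ hγ
    simp only [hdT', dif_pos (hq γ hγ).2.1]
  have hdT_rat : ∀ γ, S.orbitOf γ = S.orbitOf γ₀ → dT γ ∈ S.Gk.subgroupOf S.T := by
    intro γ hγ
    rw [Subgroup.mem_subgroupOf, hdT_val γ hγ]
    exact S.Gk.inv_mem (q γ).1.2
  have hdT'_rat : ∀ γ, S.orbitOf γ = S.orbitOf γ₀ → dT' γ ∈ S.Gk.subgroupOf S.T' := by
    intro γ hγ
    rw [Subgroup.mem_subgroupOf, hdT'_val γ hγ]
    exact (q γ).2.2
  -- (4) the compact sets `K ⊆ T`, `K' ⊆ T'`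
  set K : Set S.T := ⋃ γ ∈ Γ₁, (fun c : S.T => dT γ * c) '' closure S.DT with hK
  set K' : Set S.T' := ⋃ γ ∈ Γ₁, (fun c : S.T' => dT' γ * c) '' closure S.DT' with hK'
  have hKc : IsCompact K :=
    Γ₁.finite_toSet.isCompact_biUnion (fun γ _ => S.compT.image (continuous_const_mul _))
  have hK'c : IsCompact K' :=
    Γ₁.finite_toSet.isCompact_biUnion (fun γ _ => S.compT'.image (continuous_const_mul _))
  -- (5) phase control on `U ∩ interior V₀`
  have hγ' : (γ₀ : G) ∈ U ∩ interior V₀ := ⟨hγ, mem_interior_iff_mem_nhds.2 hV₀n⟩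
  obtain ⟨V, hVo, hγV, hVU, hV⟩ :=
    S.exists_open_phase_re_pos hχ hχ' hZ γ₀ hreg hKc hK'c (hU.inter isOpen_interior) hγ'
  -- (6) an open `V' ∋ γ₀` with `closure V' ⊆ V`
  obtain ⟨V', hV'o, hγV', hV'V, -⟩ := exists_open_between_and_isCompact_closure isCompact_singleton
    hVo (singleton_subset_iff.2 hγV)
  -- (7) the bump `b`, `f₁ = b` as a complex function
  obtain ⟨b, hb1, hb0, hbc, hb01⟩ := exists_continuous_one_zero_of_isCompact isCompact_singleton
    hV'o.isClosed_compl (disjoint_compl_right_iff_subset.2 hγV')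
  have hbnn : ∀ x, 0 ≤ b x := fun x => (hb01 x).1
  have hsuppb : Function.support b ⊆ V' := fun x hx => by
    by_contra hxV
    exact hx (hb0 hxV)
  have hf₁test : IsTest fun g : G => (b g : ℂ) :=
    ⟨Complex.continuous_ofReal.comp b.continuous, hbc.comp_left Complex.ofReal_zero⟩
  have hsupp₁ : Function.support (fun g : G => (b g : ℂ)) ⊆ V' := by
    intro x hx
    apply hsuppb
    rw [Function.mem_support] at hx ⊢
    intro h0
    apply hx
    simp [h0]
  have htsupp₁ : tsupport (fun g : G => (b g : ℂ)) ⊆ V := (closure_mono hsupp₁).trans hV'V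
  have hVV₀ : V ⊆ V₀ := (hVU.trans inter_subset_right).trans interior_subset
  refine ⟨fun g : G => (b g : ℂ), hf₁test, htsupp₁.trans (hVU.trans inter_subset_left), ?_⟩
  -- (8) the finite model of the partial kernel
  have hΓ : ∀ γ : S.Gk, γ ∉ Γ₀ → ∀ t ∈ closure S.DT, ∀ t' ∈ closure S.DT',
      (fun g : G => (b g : ℂ)) ((t : G)⁻¹ * γ * t') = 0 := fun γ hγ t ht t' ht' =>
    S.eq_zero_of_notMem_hit hV₀c (htsupp₁.trans hVV₀) hγ ht ht'
  have hrnn : ∀ (t : S.T) (t' : S.T'), 0 ≤ ∑ γ ∈ Γ₁, b ((t : G)⁻¹ * γ * t') := fun t t' =>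
    Finset.sum_nonneg (fun γ _ => hbnn _)
  have hmodel : ∀ t ∈ closure S.DT, ∀ t' ∈ closure S.DT',
      S.partialKernel (S.orbitOf γ₀) (fun g : G => (b g : ℂ)) t t' =
        ((∑ γ ∈ Γ₁, b ((t : G)⁻¹ * γ * t') : ℝ) : ℂ) := by
    intro t ht t' ht'
    rw [S.partialKernel_eq_sum hΓ (S.orbitOf γ₀) ht ht', Complex.ofReal_sum]
  -- (9) the lower bound on the real part of the orbital integrand
  have hlow : ∀ t ∈ closure S.DT, ∀ t' ∈ closure S.DT',
      (1 / 2 : ℝ) * ∑ γ ∈ Γ₁, b ((t : G)⁻¹ * γ * t') ≤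
        (S.partialKernel (S.orbitOf γ₀) (fun g : G => (b g : ℂ)) t t' * χ t *
          starRingEnd ℂ (χ' t')).re := by
    intro t ht t' ht'
    rw [hmodel t ht t' ht', mul_assoc, Complex.re_ofReal_mul]
    rcases (hrnn t t').lt_or_eq with hpos | hzero
    · obtain ⟨γ, hγΓ₁, hγpos⟩ : ∃ γ ∈ Γ₁, 0 < b ((t : G)⁻¹ * γ * t') := by
        by_contra hcon
        simp only [not_exists, not_and, not_lt] at hcon
        have : ∑ γ ∈ Γ₁, b ((t : G)⁻¹ * γ * t') = 0 :=
          Finset.sum_eq_zero (fun γ hγ => le_antisymm (hcon γ hγ) (hbnn _))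
        exact hpos.ne' this
      have hγorb : S.orbitOf γ = S.orbitOf γ₀ := (Finset.mem_filter.1 hγΓ₁).2
      obtain ⟨-, -, hγeq⟩ := hq γ hγorb
      have hmemV : (t : G)⁻¹ * γ * t' ∈ V := hV'V (subset_closure (hsuppb hγpos.ne'))
      have hcK : dT γ * t ∈ K := Set.mem_biUnion hγΓ₁ ⟨t, ht, rfl⟩
      have hc'K : dT' γ * t' ∈ K' := Set.mem_biUnion hγΓ₁ ⟨t', ht', rfl⟩
      have hγG : (γ : G) = ((q γ).1 : G) * γ₀ * ((q γ).2 : G) := by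
        have := congrArg (fun x : S.Gk => (x : G)) hγeq
        simpa using this
      have horb : ((dT γ * t : S.T) : G)⁻¹ * γ₀ * ((dT' γ * t' : S.T') : G) =
          (t : G)⁻¹ * γ * t' := by
        rw [Subgroup.coe_mul, Subgroup.coe_mul, hdT_val γ hγorb, hdT'_val γ hγorb, hγG]
        group
      have hre := hV _ hcK _ hc'K (horb ▸ hmemV)
      have hχeq : χ (dT γ * t) = χ t := by
        rw [hχ.map_mul, hχ.rational _ (hdT_rat γ hγorb), one_mul]
      have hχ'eq : χ' (dT' γ * t') = χ' t' := by
        rw [hχ'.map_mul, hχ'.rational _ (hdT'_rat γ hγorb), one_mul]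
      rw [hχeq, hχ'eq] at hre
      calc (1 / 2 : ℝ) * ∑ γ ∈ Γ₁, b ((t : G)⁻¹ * γ * t')
          = (∑ γ ∈ Γ₁, b ((t : G)⁻¹ * γ * t')) * (1 / 2) := mul_comm _ _
        _ ≤ (∑ γ ∈ Γ₁, b ((t : G)⁻¹ * γ * t')) * (χ t * starRingEnd ℂ (χ' t')).re :=
            mul_le_mul_of_nonneg_left hre.le (hrnn t t')
    · rw [← hzero]
      simp
  -- (10) open neighbourhoods of `1` whose orbit-map image lies in `{b > 0}`
  have hWo : IsOpen (Function.support b) := b.continuous.isOpen_support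
  have hγW : (γ₀ : G) ∈ Function.support b := by
    rw [Function.mem_support, hb1 (mem_singleton _)]
    exact one_ne_zero
  obtain ⟨N, hNo, h1N, N', hN'o, h1N', hNN'⟩ := S.exists_nhds_orbit_mem γ₀ hWo hγW
  -- (11) positive-measure pieces of the fundamental domains (`Gk ∩ T`, `Gk ∩ T'` are countable)
  haveI : Countable (S.Gk.subgroupOf S.T) := by
    refine Function.Injective.countable (f := fun g : S.Gk.subgroupOf S.T =>
      (⟨((g : S.T) : G), Subgroup.mem_subgroupOf.1 g.2⟩ : S.Gk)) ?_
    intro g g' hgg'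
    apply Subtype.ext
    apply Subtype.ext
    exact congrArg (fun x : S.Gk => (x : G)) hgg'
  haveI : Countable (S.Gk.subgroupOf S.T') := by
    refine Function.Injective.countable (f := fun g : S.Gk.subgroupOf S.T' =>
      (⟨((g : S.T') : G), Subgroup.mem_subgroupOf.1 g.2⟩ : S.Gk)) ?_
    intro g g' hgg'
    apply Subtype.ext
    apply Subtype.ext
    exact congrArg (fun x : S.Gk => (x : G)) hgg'
  obtain ⟨g, N₁, hN₁D, hN₁pos, hN₁⟩ := exists_subset_fd_pos_measure S.fdT hNo h1N
  obtain ⟨g', N₁', hN₁'D, hN₁'pos, hN₁'⟩ := exists_subset_fd_pos_measure S.fdT' hN'o h1N'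
  -- (12) the sum is positive on `N₁ × N₁'`
  have hrpos : ∀ t ∈ N₁, ∀ t' ∈ N₁', 0 < ∑ γ ∈ Γ₁, b ((t : G)⁻¹ * γ * t') := by
    intro t ht t' ht'
    have hgG : ((g : S.T) : G) ∈ S.Gk := Subgroup.mem_subgroupOf.1 g.2
    have hg'G : ((g' : S.T') : G) ∈ S.Gk := Subgroup.mem_subgroupOf.1 g'.2
    set γ : S.Gk := ⟨((g : S.T) : G) * γ₀ * ((g' : S.T') : G)⁻¹,
      S.Gk.mul_mem (S.Gk.mul_mem hgG γ₀.2) (S.Gk.inv_mem hg'G)⟩ with hγdef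
    have hγval : (γ : G) = ((g : S.T) : G) * γ₀ * ((g' : S.T') : G)⁻¹ := rfl
    have hγorb : S.orbitOf γ = S.orbitOf γ₀ := by
      apply ((DoubleCoset.eq _ _ _ _).2 _).symm
      refine ⟨⟨((g : S.T) : G), hgG⟩, ?_, ⟨((g' : S.T') : G)⁻¹, S.Gk.inv_mem hg'G⟩, ?_, ?_⟩
      · rw [Subgroup.mem_subgroupOf]
        exact (g : S.T).2
      · rw [Subgroup.mem_subgroupOf]
        exact S.T'.inv_mem (g' : S.T').2
      · rfl
    have hpt : (t : G)⁻¹ * γ * t' =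
        (((g : S.T)⁻¹ * t : S.T) : G)⁻¹ * γ₀ * (((g' : S.T')⁻¹ * t' : S.T') : G) := by
      rw [hγval]
      push_cast
      group
    have hmemW : (t : G)⁻¹ * γ * t' ∈ Function.support b := by
      rw [hpt]
      exact hNN' _ (hN₁ t ht) _ (hN₁' t' ht')
    have hγΓ₀ : γ ∈ Γ₀ := by
      rw [hΓ₀, Set.Finite.mem_toFinset]
      exact ⟨t, subset_closure (hN₁D ht), t', subset_closure (hN₁'D ht'),
        hVV₀ (hV'V (subset_closure (hsuppb hmemW)))⟩
    have hγΓ₁ : γ ∈ Γ₁ := Finset.mem_filter.2 ⟨hγΓ₀, hγorb⟩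
    have hbpos : 0 < b ((t : G)⁻¹ * γ * t') := lt_of_le_of_ne (hbnn _) (Ne.symm hmemW)
    exact lt_of_lt_of_le hbpos
      (Finset.single_le_sum (f := fun γ : S.Gk => b ((t : G)⁻¹ * γ * t')) (fun γ _ => hbnn _) hγΓ₁)
  -- (13) the real part of the orbital term is the iterated integral of the real parts
  have hint_inner : ∀ t ∈ closure S.DT, IntegrableOn (fun t' : S.T' =>
      S.partialKernel (S.orbitOf γ₀) (fun g : G => (b g : ℂ)) t t' * χ t * starRingEnd ℂ (χ' t'))
      S.DT' S.μT' := fun t ht =>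
    S.integrableOn_orbital_integrand hf₁test hχ.cont hχ'.cont (S.orbitOf γ₀) ht
  have hre_inner : ∀ t ∈ closure S.DT, (∫ t' in S.DT',
      S.partialKernel (S.orbitOf γ₀) (fun g : G => (b g : ℂ)) t t' * χ t * starRingEnd ℂ (χ' t')
        ∂S.μT').re = ∫ t' in S.DT', (S.partialKernel (S.orbitOf γ₀) (fun g : G => (b g : ℂ)) t t' *
          χ t * starRingEnd ℂ (χ' t')).re ∂S.μT' := by
    intro t ht
    have := Complex.reCLM.integral_comp_comm (hint_inner t ht)
    simp only [Complex.reCLM_apply] at this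
    exact this.symm
  have hre_outer : (S.orbital χ χ' (S.orbitOf γ₀) (fun g : G => (b g : ℂ))).re =
      ∫ t in S.DT, (∫ t' in S.DT', S.partialKernel (S.orbitOf γ₀) (fun g : G => (b g : ℂ)) t t' *
        χ t * starRingEnd ℂ (χ' t') ∂S.μT').re ∂S.μT := by
    rw [orbital_def]
    have := Complex.reCLM.integral_comp_comm
      (S.integrableOn_orbital_inner hf₁test hχ.cont hχ'.cont (S.orbitOf γ₀))
    simp only [Complex.reCLM_apply] at this
    exact this.symm
  -- the real inner integral `Fr`
  have hFr_eq : ∀ t ∈ closure S.DT, (∫ t' in S.DT', S.partialKernel (S.orbitOf γ₀)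
      (fun g : G => (b g : ℂ)) t t' * χ t * starRingEnd ℂ (χ' t') ∂S.μT').re =
      ∫ t' in S.DT', (S.partialKernel (S.orbitOf γ₀) (fun g : G => (b g : ℂ)) t t' * χ t *
        starRingEnd ℂ (χ' t')).re ∂S.μT' := hre_inner
  -- non-negativity of the real integrand on the closures
  have hnn_pt : ∀ t ∈ closure S.DT, ∀ t' ∈ closure S.DT', 0 ≤ (S.partialKernel (S.orbitOf γ₀)
      (fun g : G => (b g : ℂ)) t t' * χ t * starRingEnd ℂ (χ' t')).re := fun t ht t' ht' =>
    le_trans (mul_nonneg (by norm_num) (hrnn t t')) (hlow t ht t' ht')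
  -- the inner real integral is non-negative on `closure DT`, positive on `N₁`
  have hFr_nn : ∀ t ∈ closure S.DT, 0 ≤ ∫ t' in S.DT', (S.partialKernel (S.orbitOf γ₀)
      (fun g : G => (b g : ℂ)) t t' * χ t * starRingEnd ℂ (χ' t')).re ∂S.μT' := by
    intro t ht
    apply integral_nonneg_of_ae
    apply ae_restrict_of_ae_restrict_of_subset subset_closure
    rw [ae_restrict_iff' isClosed_closure.measurableSet]
    exact Filter.Eventually.of_forall fun t' ht' => hnn_pt t ht t' ht'
  have hFr_pos : ∀ t ∈ N₁, 0 < ∫ t' in S.DT', (S.partialKernel (S.orbitOf γ₀)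
      (fun g : G => (b g : ℂ)) t t' * χ t * starRingEnd ℂ (χ' t')).re ∂S.μT' := by
    intro t ht
    have ht' : t ∈ closure S.DT := subset_closure (hN₁D ht)
    have hintre : IntegrableOn (fun t' : S.T' => (S.partialKernel (S.orbitOf γ₀)
        (fun g : G => (b g : ℂ)) t t' * χ t * starRingEnd ℂ (χ' t')).re) S.DT' S.μT' := by
      have := Complex.reCLM.integrable_comp (hint_inner t ht')
      simp only [Complex.reCLM_apply] at this
      exact this
    rw [setIntegral_pos_iff_support_of_nonneg_ae _ hintre]
    · refine lt_of_lt_of_le hN₁'pos (measure_mono ?_)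
      intro s hs
      refine ⟨?_, hN₁'D hs⟩
      rw [Function.mem_support]
      exact (lt_of_lt_of_le (mul_pos (by norm_num) (hrpos t ht s hs))
        (hlow t ht' s (subset_closure (hN₁'D hs)))).ne'
    · apply ae_restrict_of_ae_restrict_of_subset subset_closure
      rw [ae_restrict_iff' isClosed_closure.measurableSet]
      exact Filter.Eventually.of_forall fun s hs => hnn_pt t ht' s hs
  -- (14) assemble
  rw [hre_outer]
  have hcongr : ∫ t in S.DT, (∫ t' in S.DT', S.partialKernel (S.orbitOf γ₀) (fun g : G => (b g : ℂ)) t t' *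
        χ t * starRingEnd ℂ (χ' t') ∂S.μT').re ∂S.μT =
      ∫ t in S.DT, (∫ t' in S.DT', (S.partialKernel (S.orbitOf γ₀) (fun g : G => (b g : ℂ)) t t' *
        χ t * starRingEnd ℂ (χ' t')).re ∂S.μT') ∂S.μT := by
    apply integral_congr_ae
    apply ae_restrict_of_ae_restrict_of_subset subset_closure
    rw [ae_restrict_iff' isClosed_closure.measurableSet]
    exact Filter.Eventually.of_forall fun t ht => hFr_eq t ht
  rw [hcongr]
  have hint_outer : IntegrableOn (fun t : S.T => ∫ t' in S.DT', (S.partialKernel (S.orbitOf γ₀)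
      (fun g : G => (b g : ℂ)) t t' * χ t * starRingEnd ℂ (χ' t')).re ∂S.μT') S.DT S.μT := by
    have h1 : IntegrableOn (fun t : S.T => (∫ t' in S.DT', S.partialKernel (S.orbitOf γ₀)
        (fun g : G => (b g : ℂ)) t t' * χ t * starRingEnd ℂ (χ' t') ∂S.μT').re)
        (closure S.DT) S.μT := by
      have := Complex.reCLM.integrable_comp
        (S.integrableOn_orbital_inner_closure hf₁test hχ.cont hχ'.cont (S.orbitOf γ₀))
      simp only [Complex.reCLM_apply] at this
      exact this
    exact (h1.congr_fun (fun t ht => hFr_eq t ht) isClosed_closure.measurableSet).mono_set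
      subset_closure
  rw [setIntegral_pos_iff_support_of_nonneg_ae _ hint_outer]
  · refine lt_of_lt_of_le hN₁pos (measure_mono ?_)
    intro t ht
    exact ⟨(hFr_pos t ht).ne', hN₁D ht⟩
  · apply ae_restrict_of_ae_restrict_of_subset subset_closure
    rw [ae_restrict_iff' isClosed_closure.measurableSet]
    exact Filter.Eventually.of_forall fun t ht => hFr_nn t ht

end Setting

end Summit.Ventures.HodgeRepro.Tier4.Line1.RTF

end
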